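import Summits.ABC.IUTFork.Cor312LicenceRealSharpMovers
import Summits.ABC.IUTFork.Thm311RealIsmDHOrbitSpan
import Summits.ABC.IUTFork.Cor312PinnedThetaRealSharpNegative
import Summits.ABC.IUTFork.Conditional.AbcOfSGenuineAntecedent
import HarnessLib

/-!
# [IUTchIII] Cor. 3.12 — the (xi-f) LICENCE, the S_H antecedent and the typed STATEMENT HOLD at the SHARP genuine
# real setting for shallow honestly-scaled ideles at a TAMELY RAMIFIED bad prime (E3 CASE B is satisfiable)

PROOF-ONLY file (0 definitions, 0 named `Prop` facts; abc-iut cell, WAVE-4 prover seat abc-iut-w4-d087, gen 5; own-lineage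
support piece «LICENCE-AT-SHARP-RAMIFIED», part 2 of 3). TAKES NO SIDE on [IUTchIII] Cor. 3.12.

E3 RESULT of record (abc-iut-C-cert-2 p433074/p433664; abc-iut-w5-d107 p433872): at abc-iut-c312-7's print-normalised
sharp assembled real setting `Real.settingPrVolSharp` with realising pilot ideles, ONE bad place over an ODD prime
UNRAMIFIED in `F` kernel-refutes the typed (xi-f) licence `Thm311ToCor312.Licence` ([IUTchIII] Cor. 3.12 proof, Step
(xi), kurims `paper:url-4b091feeb646` p. 184 l. 19–29: the q-pilot image lies in the holomorphic hull `^{n,∘}𝒰` of the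
union of the possible images) — CASE A; CASE B (all bad places over `2` or over RAMIFIED primes) was OPEN.

THIS FILE DECIDES A CASE-B FAMILY POSITIVELY in our typing. At a TAME place (`p₀ > 2`, `e := e(x₀|p₀) ≤ p₀ − 2`) the
lattice `log_p(𝒪^×_{x₀})` is the ball `𝔪_{x₀} = {‖y‖ ≤ ‖ϖ‖}` (campaign-S `prop12iEq_holds`, abc-iut-w5-d216
`logUnits_eq_closedBall_of_tame`) and Dupuy–Hilado's typed (Ind2) `Real.ismDH` (bicontinuous `ℚ`-linear automorphisms
of `K_{x₀}` fixing the log-shell, §4.9) is TRANSITIVE on the primitive vectors of every `p^k·log_p(𝒪^×)` (abc-iut-w5-d180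
`exists_mem_ismDH_apply_eq_of_primitive`, Weil BNT II §2). Hence (§1, `exists_mem_ismDH_norm_eq_zpow_of_tame`) an
element of norm `‖ϖ‖^m` with `e·k + 1 ≤ m ≤ e·k + e` is carried by some (Ind2)-element to norm `‖ϖ‖^{e·k+1}`: the unit
`1` to norm `‖ϖ‖^{1−e}` (the INFLATION of the unit factors `𝒪_{x₀} ↦ I_{x₀} = ϖ^{1−e}·𝒪_{x₀}`), the Θ-idele `t_{Θ,j,x₀}`
(norm `‖ϖ‖^{b_j}`) to norm `‖ϖ‖^{e·k_j+1}`. With part 1's mover criterion at a prime `p₀` carrying a UNIQUE place `x₀`: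

* `qRegion_subset_thetaHull_settingPrVolSharp_of_tame` — at the label `j = i+1`, if
  `(1 − e)·(i+1) + e·k_i + 1 ≤ n_q` (`‖t_{q,x₀}‖ = ‖ϖ‖^{n_q}`), then `qRegion (i+1) p₀ ⊆ thetaHull (i+1) p₀`;
* **`licence_settingPrVolSharp_of_tame`** — if moreover every bad place lies over `p₀` (Θ- and q-ideles units off `S`),
  the typed (xi-f) licence `Thm311ToCor312.Licence (settingPrVolSharp …)` HOLDS;
* **`exists_qPinned_and_pilotKummerCompatHull_settingPrVolSharp_of_tame`** — so does the branch-C S_H antecedent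
  `∃ ρ qK, QPinned ∧ PilotKummerCompatHull` (abc-iut-C-cert-1 `exists_qPinned_and_hull_iff`; `‖t_q‖ ≤ 1` at the label `0`):
  a NON-VACUITY WITNESS of the v3/v4 per-datum IUT-side bundle AT A GENUINE SHARP REAL SETTING (cf. C-R10c / p431727:
  only interface-level witnesses existed);
* **`statement_settingPrVolSharp_of_tame`** — hence the typed Cor. 3.12 `Statement` (`−|log(Θ)| ∈ ℝ` and
  `−|log(q)| ≤ −|log(Θ)|`) HOLDS at that setting (`Thm311ToCor312.statement_of_licence`, c312-7
  `bridgeHyps_settingPrVolSharp_of_ideles`);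
* part 3 (`Cor312LicenceRealSharpTameHonest`, `statement_settingPrVolSharp_of_tame_honest`) instantiates the side
  conditions at the honestly `j²`-scaled unit-depth profile `‖t_{q,x₀}‖ = ‖ϖ‖`, `‖t_{Θ,i+1,x₀}‖ = ‖ϖ‖^{(i+1)²}`
  (Dupuy–Hilado (3.4) with `P_{Θ,j} = j²·P_q`) under `l⋇² ≤ e ≤ p₀ − 2` (`k_i = 0`). Example of field data (prose):
  `l = 5`, `F = ℚ(7^{1/4})`, `x₀` the unique (totally, tamely ramified, `e = 4`) place over `p₀ = 7`, `S = {x₀}`.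

READING (neutral, for §D/§K of the adjudication record): in OUR typing the (xi-f) licence / S_H antecedent at the sharp
genuine setting is REFUTED in case A (odd unramified bad prime, any depth) and SATISFIED in this case-B family (tamely
ramified unique bad place, shallow ideles): the E3 dichotomy is STRICT, and the mechanism that makes the typed Corollary
hold here is the (Ind2)-inflation of the Θ-hull at RAMIFIED places by `‖ϖ‖^{(1−e)(j+1)}` per packet — the log-shell /
different discrepancy of [IUTchIV] Prop. 1.2, Thm. 1.10 Step (v)–(vi) — under the reading of (Ind2) as ALL shell-preserving
lattice automorphisms (Dupuy–Hilado §4.9); under the ISOMETRY reading no such inflation exists (abc-iut-c312-14). HONEST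
SCOPE: the pilot data `X`, ideles and field are binders satisfying the stated norm profile — NOT an initial Θ-datum of
[IUTchI] Def. 3.1 (whose `F ⊇ ℚ(√−1, E[l])` is ramified at several primes); the sharp (Ind3) reading; the trivial
archimedean container. Nothing here asserts [IUTchIII] Cor. 3.12 for initial Θ-data or bears on abc.
[claim: Mochizuki2012, status: disputed] for every [IUTchIII]/[IUTchIV] locution; [cite: DupuyHilado2025, §3.4, §3.7, §3.9,
§4.9]; [cite: WeilBNT1967, Ch. II §2, Th. 1]; [cite: NeukirchANT1999, Ch. II Prop. (5.5)]; [cite: ScholzeStix2018, §2.2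
pp. 9–10]. Consumed BY NAME, nothing restated. typed ≠ proved; instantiated ≠ endorsed.
-/

noncomputable section

open Metric Set Function NumberField IsDedekindDomain
open scoped Pointwise

namespace Summit.ABC.IUTFork.Thm311.Real

open Cor312 Cor312Vol Literature.IUT.LogThetaLattice Literature.IUT.LogVolume
  Literature.NumberTheory.NumberFields Literature.NumberTheory.GaloisRepresentations.Ultrametric

/-! ## §1. The reach of DH's (Ind2) at a tame place: norm `‖ϖ‖^m ↦ ‖ϖ‖^{e·⌊(m−1)/e⌋+1}` -/

/-- **The reach of Dupuy–Hilado's (Ind2) at a TAME place** (`p > 2`, `e = e(v|p) ≤ p − 2`, uniformizer `ϖ`): an element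
`x` of norm `‖ϖ‖^m` with `e·k + 1 ≤ m ≤ e·k + e` is a PRIMITIVE vector of the lattice `p^k·log_p(𝒪_v^×) = {‖y‖ ≤ ‖ϖ‖^{e·k+1}}`
(`log_p(𝒪_v^×) = 𝔪_v`), hence is carried by some `g ∈ Real.ismDH` to the primitive vector `ϖ^{e·k+1}` of MAXIMAL norm
`‖ϖ‖^{e·k+1}` (abc-iut-w5-d180: (Ind2) is transitive on primitive vectors; Weil BNT II §2 Th. 1). For `x = 1` (`m = 0`,
`k = −1`): norm `‖ϖ‖^{1−e} > 1` when `e ≥ 2` — the inflation of the unit ball. [cite: WeilBNT1967, Ch. II §2, Th. 1]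
[cite: NeukirchANT1999, Ch. II Prop. (5.5)] [cite: DupuyHilado2025, §4.9] -/
theorem exists_mem_ismDH_norm_eq_zpow_of_tame {F : Type} [Field F] [NumberField F] {p : ℕ} [Fact p.Prime]
    {logv : PadicLogs F} (hlogp : LogvAnalyticAt p logv) (v : HeightOneSpectrum (𝓞 F))
    (hv : ((p : ℕ) : 𝓞 F) ∈ v.asIdeal) (hp2 : 2 < p) (he : v.asIdeal.ramificationIdx ℤ ≤ p - 2)
    {ϖ : (RescaledCompletion F p v hv)ˣ} (hϖ : IsUniformizer ϖ)
    {x : RescaledCompletion F p v hv} {m k : ℤ} (hx : ‖x‖ = ‖(ϖ : RescaledCompletion F p v hv)‖ ^ m)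
    (hk1 : (v.asIdeal.ramificationIdx ℤ : ℤ) * k + 1 ≤ m)
    (hk2 : m ≤ (v.asIdeal.ramificationIdx ℤ : ℤ) * k + v.asIdeal.ramificationIdx ℤ) :
    ∃ g ∈ ismDH logv (.inr v : Place F),
      ‖toR p v hv (g (ofR p v hv x))‖ =
        ‖(ϖ : RescaledCompletion F p v hv)‖ ^ ((v.asIdeal.ramificationIdx ℤ : ℤ) * k + 1) := by
  have hϖ0 : 0 < ‖(ϖ : RescaledCompletion F p v hv)‖ := norm_pos_iff.mpr ϖ.ne_zero
  have hϖ1 : ‖(ϖ : RescaledCompletion F p v hv)‖ < 1 := hϖ.1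
  have he1 : 1 ≤ (v.asIdeal.ramificationIdx ℤ : ℤ) := by
    have h := absRamificationIdx_pos p (RescaledCompletion F p v hv)
    rw [absRamificationIdx_rescaledCompletion F p v hv] at h
    exact_mod_cast h
  have hpe : ‖(ϖ : RescaledCompletion F p v hv)‖ ^ (v.asIdeal.ramificationIdx ℤ : ℤ) = (p : ℝ)⁻¹ := by
    rw [zpow_natCast, ← absRamificationIdx_rescaledCompletion F p v hv]
    exact norm_pow_absRamificationIdx p (RescaledCompletion F p v hv) hϖ
  have hnp : ∀ k : ℤ, ‖((p : ℚ_[p]) ^ k)‖ =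
      ‖(ϖ : RescaledCompletion F p v hv)‖ ^ ((v.asIdeal.ramificationIdx ℤ : ℤ) * k) := by
    intro k
    rw [norm_zpow, Padic.norm_p, ← hpe, ← zpow_mul]
  -- the lattices `p^k • log_p(𝒪^×)` are the balls `{‖y‖ ≤ ‖ϖ‖^(e·k+1)}`
  have hΛ : (logUnits (RescaledCompletion F p v hv) : Set (RescaledCompletion F p v hv)) =
      closedBall 0 ‖(ϖ : RescaledCompletion F p v hv)‖ := logUnits_eq_closedBall_of_tame hp2 he hϖ
  have hmem : ∀ (z : RescaledCompletion F p v hv) (k : ℤ),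
      z ∈ ((p : ℚ_[p]) ^ k) • (logUnits (RescaledCompletion F p v hv) : Set (RescaledCompletion F p v hv)) ↔
        ‖z‖ ≤ ‖(ϖ : RescaledCompletion F p v hv)‖ ^ ((v.asIdeal.ramificationIdx ℤ : ℤ) * k + 1) := by
    intro z k
    rw [hΛ, smul_closedBall _ _ (norm_nonneg _), smul_zero, hnp, mem_closedBall_zero_iff, zpow_add₀ hϖ0.ne',
      zpow_one]
  have hpc : (p : ℚ_[p]) * (p : ℚ_[p]) ^ k = (p : ℚ_[p]) ^ (k + 1) := by
    rw [zpow_add_one₀ (Nat.cast_ne_zero.mpr (Fact.out : p.Prime).ne_zero), mul_comm]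
  have hle : ∀ {a b : ℤ}, ‖(ϖ : RescaledCompletion F p v hv)‖ ^ a ≤ ‖(ϖ : RescaledCompletion F p v hv)‖ ^ b ↔ b ≤ a :=
    fun {a b} => zpow_le_zpow_iff_right_of_lt_one₀ hϖ0 hϖ1
  have hek : (v.asIdeal.ramificationIdx ℤ : ℤ) * (k + 1) + 1 =
      (v.asIdeal.ramificationIdx ℤ : ℤ) * k + v.asIdeal.ramificationIdx ℤ + 1 := by ring
  have hynorm : ‖(ϖ : RescaledCompletion F p v hv) ^ ((v.asIdeal.ramificationIdx ℤ : ℤ) * k + 1)‖ =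
      ‖(ϖ : RescaledCompletion F p v hv)‖ ^ ((v.asIdeal.ramificationIdx ℤ : ℤ) * k + 1) := norm_zpow _ _
  obtain ⟨g, hg, hgx⟩ := exists_mem_ismDH_apply_eq_of_primitive hlogp v hv (c := (p : ℚ_[p]) ^ k)
    (y := (ϖ : RescaledCompletion F p v hv) ^ ((v.asIdeal.ramificationIdx ℤ : ℤ) * k + 1))
    ((hmem x k).2 (by rw [hx]; exact hle.2 hk1))
    (by
      rw [hpc, hmem, hx, hle, hek]
      omega)
    ((hmem _ k).2 (by rw [hynorm]))
    (by
      rw [hpc, hmem, hynorm, hle, hek]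
      omega)
  exact ⟨g, hg, by rw [hgx, hynorm]⟩

/-! ## §2. The licence at the sharp genuine setting with a unique, tamely ramified bad place -/

section Assembled

variable {F : Type} [Field F] [NumberField F] (X : PilotData F) {logv : PadicLogs F} (hlog : LogvAnalytic logv)
  (M : Type) [Field M] [NumberField M]
  (archPk : ∀ (j : (thetaIndex X).Label) (vQ : (thetaIndex X).VQ), Set ((logShellsDH X logv).Packet j vQ))
  (archSub : ∀ (j : (thetaIndex X).Label) (v : (thetaIndex X).V),
    Set ((logShellsDH X logv).Packet j ((thetaIndex X).over v)))
  (Ψ : ℤ → ∀ v : (thetaIndex X).V, v ∈ (thetaIndex X).Vbad → Set ((logShellsDH X logv).StarPacket v))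
  (act : ℤ → ∀ v : (thetaIndex X).V, v ∈ (thetaIndex X).Vbad →
    (logShellsDH X logv).StarPacket v → Module.End ℚ ((logShellsDH X logv).StarPacket v))
  (Mmod : ℤ → ∀ j : (thetaIndex X).LabelStar, Set ((logShellsDH X logv).GlobalPacket j.1))
  (region : ℤ → ∀ j : (thetaIndex X).LabelStar, FinDivisor M → ∀ vQ : (thetaIndex X).VQ,
    Set ((logShellsDH X logv).Packet j.1 vQ))
  (n : ℤ) {HT : Type} {LogLink : HT → HT → Type} {IsFull : ∀ {s t : HT}, LogLink s t → Prop}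
  (lat : LGPGaussianLogThetaLattice LogLink IsFull)
  {Frd : Type} {IsoF : Frd → Frd → Type} {Ob : Frd → Type} {realify : Frd → Frd} {Strip : Type}
  {IsoS : Strip → Strip → Type} {Mv : ∀ v : (thetaIndex X).V, v ∈ (thetaIndex X).Vbad → Type}
  [∀ v h, Monoid (Mv v h)]
  (sig : GlobalLGPFrobenioidSignature (thetaIndex X).lstar (thetaIndex X).V (· ∈ (thetaIndex X).Vbad)
    Frd IsoF Ob realify Strip IsoS Mv)
  (split : SplittingMonoids Mv) {ObΔ : Type} {N : ∀ v : (thetaIndex X).V, v ∈ (thetaIndex X).Vbad → Type}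
  [∀ v h, Monoid (N v h)] (qData : QPilotData ObΔ N)
  (tq : ∀ (pp : Nat.Primes) (x : (thetaIndex X).Fibre (.inr pp)),
    haveI : Fact (pp : ℕ).Prime := ⟨pp.2⟩; kOf X pp.1 x)
  (t : ∀ (pp : Nat.Primes) (_ : Fin X.lstar) (x : (thetaIndex X).Fibre (.inr pp)),
    haveI : Fact (pp : ℕ).Prime := ⟨pp.2⟩; kOf X pp.1 x)
  (htq0 : ∀ pp x, tq pp x ≠ 0)
  (htq1 : ∀ (pp : Nat.Primes) (x : (thetaIndex X).Fibre (.inr pp)),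
    haveI : Fact (pp : ℕ).Prime := ⟨pp.2⟩; placeOf X pp.1 x ∉ X.S → ‖tq pp x‖ = 1)
  (ht0 : ∀ pp i x, t pp i x ≠ 0)
  -- the tamely ramified place `⟨.inr v₀, hv₀⟩ = (inr v₀, hv₀)`, UNIQUE over `p₀`
  (pp₀ : Nat.Primes) [Fact (pp₀ : ℕ).Prime] (v₀ : HeightOneSpectrum (𝓞 F))
  (hv₀ : (thetaIndex X).over (.inr v₀) = .inr pp₀)
  (huniq : ∀ x : (thetaIndex X).Fibre (.inr pp₀), x = ⟨.inr v₀, hv₀⟩)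
  (hp2 : 2 < (pp₀ : ℕ)) (he : v₀.asIdeal.ramificationIdx ℤ ≤ (pp₀ : ℕ) - 2)
  {ϖ : (kOf X pp₀.1 ⟨.inr v₀, hv₀⟩)ˣ} (hϖ : IsUniformizer ϖ)
  -- the idele depths at `⟨.inr v₀, hv₀⟩` in powers of `‖ϖ‖`
  (nq : ℤ) (hnq : ‖tq pp₀ ⟨.inr v₀, hv₀⟩‖ = ‖(ϖ : kOf X pp₀.1 ⟨.inr v₀, hv₀⟩)‖ ^ nq)
  (b k : Fin X.lstar → ℤ) (hb : ∀ i, ‖t pp₀ i ⟨.inr v₀, hv₀⟩‖ = ‖(ϖ : kOf X pp₀.1 ⟨.inr v₀, hv₀⟩)‖ ^ b i)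
  (hk : ∀ i, (v₀.asIdeal.ramificationIdx ℤ : ℤ) * k i + 1 ≤ b i ∧
    b i ≤ (v₀.asIdeal.ramificationIdx ℤ : ℤ) * k i + v₀.asIdeal.ramificationIdx ℤ)

include hlog huniq hp2 he hϖ hnq hb hk ht0

/-- **`q-region ⊆ Θ-hull` at a label `i+1` over the unique tamely ramified bad prime `p₀`**, whenever the (Ind2)-reach
covers the `q`-depth: `(1 − e)·(i+1) + e·k_i + 1 ≤ n_q`. The movers: on the `i+1` unit factors the (Ind2)-element
carrying `1` to norm `‖ϖ‖^{1−e}`, on the last factor the one carrying `t_{Θ,i+1,x₀}` to norm `‖ϖ‖^{e·k_i+1}` (§1); their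
tensor product carries the pure tensor `1 ⊗ ⋯ ⊗ 1 ⊗ t_{Θ,i+1,x₀}` of the sharp Θ-box to a possible-image point of
field-factor norms `‖ϖ‖^{(1−e)(i+1)+e·k_i+1} ≥ ‖t_{q,x₀}‖` (part 1 `qRegion_subset_thetaHull_settingPrVolSharp_of_movers`).
[cite: DupuyHilado2025, §3.9, §4.9] [cite: WeilBNT1967, Ch. II §2, Th. 1] [claim: Mochizuki2012, status: disputed] -/
theorem qRegion_subset_thetaHull_settingPrVolSharp_of_tame (i : Fin (thetaIndex X).lstar)
    (hineq : (1 - (v₀.asIdeal.ramificationIdx ℤ : ℤ)) * ((i : ℕ) + 1 : ℤ) +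
      (v₀.asIdeal.ramificationIdx ℤ : ℤ) * k i + 1 ≤ nq) :
    (settingPrVolSharp X hlog M archPk archSub Ψ act Mmod region n lat sig split qData tq t htq0 htq1).qRegion
        (Setting.labelSucc i) (.inr pp₀) ⊆
      (settingPrVolSharp X hlog M archPk archSub Ψ act Mmod region n lat sig split qData tq t htq0 htq1).thetaHull
        (Setting.labelSucc i) (.inr pp₀) := by
  classical
  have hv : ((pp₀ : ℕ) : 𝓞 F) ∈ v₀.asIdeal := natCast_mem_placeOf X pp₀.1 ⟨.inr v₀, hv₀⟩
  have hϖ0 : 0 < ‖(ϖ : kOf X pp₀.1 ⟨.inr v₀, hv₀⟩)‖ := norm_pos_iff.mpr ϖ.ne_zero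
  have hϖ1 : ‖(ϖ : kOf X pp₀.1 ⟨.inr v₀, hv₀⟩)‖ < 1 := hϖ.1
  have he1 : 1 ≤ (v₀.asIdeal.ramificationIdx ℤ : ℤ) := by
    have h : 0 < absRamificationIdx pp₀.1 (RescaledCompletion F pp₀.1 v₀ hv) := absRamificationIdx_pos _ _
    rw [absRamificationIdx_rescaledCompletion F pp₀.1 v₀ hv] at h
    exact_mod_cast h
  have hlab : ((Setting.labelSucc i : (thetaIndex X).Label) : ℕ) = (i : ℕ) + 1 := by
    simp [Setting.labelSucc]
  -- the two movers (the reach lemma is instantiated over `kOf X p₀ x₀ = RescaledCompletion F p₀ (placeOf x₀) _`,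
  -- `placeOf x₀ = v₀` definitionally)
  have he1' : 1 ≤ ((placeOf X pp₀.1 ⟨.inr v₀, hv₀⟩).asIdeal.ramificationIdx ℤ : ℤ) := he1
  obtain ⟨gA, hgA, hgA1⟩ := exists_mem_ismDH_norm_eq_zpow_of_tame (F := F) (hlog pp₀) (placeOf X pp₀.1 ⟨.inr v₀, hv₀⟩)
    (natCast_mem_placeOf X pp₀.1 ⟨.inr v₀, hv₀⟩) hp2 he hϖ (x := (1 : kOf X pp₀.1 ⟨.inr v₀, hv₀⟩)) (m := 0) (k := -1)
    (by rw [zpow_zero]; exact norm_one) (by omega) (by omega)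
  obtain ⟨gB, hgB, hgB1⟩ := exists_mem_ismDH_norm_eq_zpow_of_tame (F := F) (hlog pp₀) (placeOf X pp₀.1 ⟨.inr v₀, hv₀⟩)
    (natCast_mem_placeOf X pp₀.1 ⟨.inr v₀, hv₀⟩) hp2 he hϖ (x := t pp₀ i ⟨.inr v₀, hv₀⟩) (m := b i) (k := k i) (hb i)
    (hk i).1 (hk i).2
  let g : ℕ → (Carrier (.inr v₀ : Place F) ≃ₗ[ℚ] Carrier (.inr v₀ : Place F)) := fun a =>
    if a = (i : ℕ) + 1 then gB else gA
  have hg : ∀ a, g a ∈ ismDH logv (.inr v₀ : Place F) := fun a => by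
    show (if a = (i : ℕ) + 1 then gB else gA) ∈ _
    split_ifs
    · exact hgB
    · exact hgA
  let w : (thetaIndex X).Caps (Setting.labelSucc i) → ∀ x : (thetaIndex X).Fibre (.inr pp₀), kOf X pp₀.1 x :=
    fun a x => if (a : ℕ) = (i : ℕ) + 1 then t pp₀ i x else 1
  -- evaluation of `w` and `g` at the last coordinate and at the others
  have hlast : ((Fin.last ((Setting.labelSucc i : (thetaIndex X).Label) : ℕ) :
      (thetaIndex X).Caps (Setting.labelSucc i)) : ℕ) = (i : ℕ) + 1 := by
    rw [Fin.val_last, hlab]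
  have hcast : ∀ a : Fin ((Setting.labelSucc i : (thetaIndex X).Label) : ℕ),
      ((Fin.castSucc a : (thetaIndex X).Caps (Setting.labelSucc i)) : ℕ) ≠ (i : ℕ) + 1 := by
    intro a h
    have ha : (a : ℕ) < ((Setting.labelSucc i : (thetaIndex X).Label) : ℕ) := a.2
    rw [Fin.val_castSucc] at h
    omega
  have hw_last : w (Fin.last _) ⟨.inr v₀, hv₀⟩ = t pp₀ i ⟨.inr v₀, hv₀⟩ := by
    show (if ((Fin.last _ : (thetaIndex X).Caps (Setting.labelSucc i)) : ℕ) = (i : ℕ) + 1 then _ else _) = _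
    rw [if_pos hlast]
  have hw_cast : ∀ a : Fin ((Setting.labelSucc i : (thetaIndex X).Label) : ℕ), w (Fin.castSucc a) ⟨.inr v₀, hv₀⟩ = 1 := by
    intro a
    show (if ((Fin.castSucc a : (thetaIndex X).Caps (Setting.labelSucc i)) : ℕ) = (i : ℕ) + 1 then _ else _) = _
    rw [if_neg (hcast a)]
  have hg_last : g ((Fin.last _ : (thetaIndex X).Caps (Setting.labelSucc i)) : ℕ) = gB := by
    show (if ((Fin.last _ : (thetaIndex X).Caps (Setting.labelSucc i)) : ℕ) = (i : ℕ) + 1 then _ else _) = _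
    rw [if_pos hlast]
  have hg_cast : ∀ a : Fin ((Setting.labelSucc i : (thetaIndex X).Label) : ℕ),
      g ((Fin.castSucc a : (thetaIndex X).Caps (Setting.labelSucc i)) : ℕ) = gA := by
    intro a
    show (if ((Fin.castSucc a : (thetaIndex X).Caps (Setting.labelSucc i)) : ℕ) = (i : ℕ) + 1 then _ else _) = _
    rw [if_neg (hcast a)]
  refine qRegion_subset_thetaHull_settingPrVolSharp_of_movers X hlog M archPk archSub Ψ act Mmod region n lat sig split
    qData tq t htq0 htq1 ht0 pp₀ v₀ hv₀ huniq (Setting.labelSucc i) g hg w ?_ ?_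
  · -- `Π_a ‖w_a‖ = ‖t_{Θ,i+1,x₀}‖ = ‖labelIdele (i+1)‖`
    rw [Fin.prod_univ_castSucc, Finset.prod_eq_one (fun a _ => by rw [hw_cast a, norm_one]), one_mul, hw_last,
      labelIdele_labelSucc]
  · -- `‖t_{q,x₀}‖ = ‖ϖ‖^{n_q} ≤ ‖ϖ‖^{(1−e)(i+1) + e·k_i + 1} = Π_a ‖g_a(w_a)‖`
    rw [Fin.prod_univ_castSucc, hg_last, hw_last]
    have h2 : ∀ a : Fin ((Setting.labelSucc i : (thetaIndex X).Label) : ℕ),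
        ‖toR pp₀.1 v₀ (natCast_mem_placeOf X pp₀.1 ⟨.inr v₀, hv₀⟩)
            (g ((Fin.castSucc a : (thetaIndex X).Caps (Setting.labelSucc i)) : ℕ)
              (ofR pp₀.1 v₀ (natCast_mem_placeOf X pp₀.1 ⟨.inr v₀, hv₀⟩)
                (w (Fin.castSucc a) ⟨.inr v₀, hv₀⟩)))‖ =
          ‖(ϖ : kOf X pp₀.1 ⟨.inr v₀, hv₀⟩)‖ ^ ((v₀.asIdeal.ramificationIdx ℤ : ℤ) * (-1) + 1) := by
      intro a
      rw [hg_cast a, hw_cast a]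
      exact hgA1
    calc ‖tq pp₀ ⟨.inr v₀, hv₀⟩‖ = ‖(ϖ : kOf X pp₀.1 ⟨.inr v₀, hv₀⟩)‖ ^ nq := hnq
      _ ≤ ‖(ϖ : kOf X pp₀.1 ⟨.inr v₀, hv₀⟩)‖ ^
            (((v₀.asIdeal.ramificationIdx ℤ : ℤ) * (-1) + 1) * ((((i : ℕ) + 1 : ℕ)) : ℤ) +
              ((v₀.asIdeal.ramificationIdx ℤ : ℤ) * k i + 1)) := by
          refine (zpow_le_zpow_iff_right_of_lt_one₀ hϖ0 hϖ1).2 ?_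
          push_cast
          linarith
      _ = (‖(ϖ : kOf X pp₀.1 ⟨.inr v₀, hv₀⟩)‖ ^ ((v₀.asIdeal.ramificationIdx ℤ : ℤ) * (-1) + 1)) ^ ((i : ℕ) + 1) *
            ‖(ϖ : kOf X pp₀.1 ⟨.inr v₀, hv₀⟩)‖ ^ ((v₀.asIdeal.ramificationIdx ℤ : ℤ) * k i + 1) := by
          rw [zpow_add₀ hϖ0.ne', zpow_mul, zpow_natCast]
      _ = _ := by
          congr 1
          · exact ((Finset.prod_congr rfl fun a _ => h2 a).trans
              (by rw [Finset.prod_const, Finset.card_univ, Fintype.card_fin, hlab])).symm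
          · exact hgB1.symm

variable (hineq : ∀ i : Fin (thetaIndex X).lstar, (1 - (v₀.asIdeal.ramificationIdx ℤ : ℤ)) * ((i : ℕ) + 1 : ℤ) +
      (v₀.asIdeal.ramificationIdx ℤ : ℤ) * k i + 1 ≤ nq)
  (hS : ∀ (pp : Nat.Primes) (x : (thetaIndex X).Fibre (.inr pp)),
    haveI : Fact (pp : ℕ).Prime := ⟨pp.2⟩; placeOf X pp.1 x ∈ X.S → pp = pp₀)
  (ht1 : ∀ (pp : Nat.Primes) (i : Fin X.lstar) (x : (thetaIndex X).Fibre (.inr pp)),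
    haveI : Fact (pp : ℕ).Prime := ⟨pp.2⟩; placeOf X pp.1 x ∉ X.S → ‖t pp i x‖ = 1)

include hineq hS ht1

/-- **THE TYPED (xi-f) LICENCE HOLDS at the sharp genuine setting `Real.settingPrVolSharp`** (any archimedean data,
columns, context binders) when every bad place lies over ONE odd prime `p₀` carrying a UNIQUE, TAMELY RAMIFIED place `x₀`
of `F` (`e ≤ p₀ − 2`), the ideles are units off `S`, and at `x₀` the (Ind2)-reach covers the `q`-depth at every label:
`(1 − e)(i+1) + e·k_i + 1 ≤ n_q` with `e·k_i + 1 ≤ b_i ≤ e·k_i + e` (`‖t_{Θ,i+1,x₀}‖ = ‖ϖ‖^{b_i}`, `‖t_{q,x₀}‖ = ‖ϖ‖^{n_q}`).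
At the primes `≠ p₀` both pilot boxes are the unit box; at `∞` the container is trivial. CASE B of the E3 record is thus
SATISFIABLE in our typing (case A — an odd UNRAMIFIED bad prime — is refuted, abc-iut-C-cert-2 p433074/p433664).
[cite: DupuyHilado2025, §3.9, §4.9] [claim: Mochizuki2012, status: disputed] -/
theorem licence_settingPrVolSharp_of_tame :
    Thm311ToCor312.Licence
      (settingPrVolSharp X hlog M archPk archSub Ψ act Mmod region n lat sig split qData tq t htq0 htq1) := by
  intro i vQ
  rcases vQ with u | pp
  · exact (qRegion_subset_thetaRegion_settingPrVolSharp_inl X hlog M archPk archSub Ψ act Mmod region n lat sig split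
        qData tq t htq0 htq1 0 _ u).trans
      (thetaRegion_subset_thetaHull_settingPrVolSharp X hlog M archPk archSub Ψ act Mmod region n lat sig split qData tq t
        htq0 htq1 0 _ _)
  · by_cases hpp : pp = pp₀
    · subst hpp
      exact qRegion_subset_thetaHull_settingPrVolSharp_of_tame X hlog M archPk archSub Ψ act Mmod region n lat sig split
        qData tq t htq0 htq1 ht0 pp v₀ hv₀ huniq hp2 he hϖ nq hnq b k hb hk i (hineq i)
    · haveI : Fact (pp : ℕ).Prime := ⟨pp.2⟩
      refine (qRegion_subset_thetaRegion_settingPrVolSharp_inr X hlog M archPk archSub Ψ act Mmod region n lat sig split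
          qData tq t htq0 htq1 ht0 0 _ pp fun x => ?_).trans
        (thetaRegion_subset_thetaHull_settingPrVolSharp X hlog M archPk archSub Ψ act Mmod region n lat sig split qData tq
          t htq0 htq1 0 _ _)
      have hx : placeOf X pp.1 x ∉ X.S := fun hS' => hpp (hS pp x hS')
      rw [labelIdele_labelSucc, htq1 pp x hx, ht1 pp i x hx]

/-- **THE TYPED [IUTchIII] Cor. 3.12 `Statement` HOLDS at that sharp genuine setting** (`−|log(Θ)| ∈ ℝ` and
`−|log(q)| ≤ −|log(Θ)|`): the licence (above) plus abc-iut-c312-6's `BridgeHyps`, which abc-iut-c312-7 proved at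
`settingPrVolSharp` for non-zero ideles that are units off `S` (`bridgeHyps_settingPrVolSharp_of_ideles`), give it by
`Thm311ToCor312.statement_of_licence`. A POSITIVE instance of the typed Corollary at a genuine (non-toy) real setting —
under DH's (Ind2) as lattice automorphisms; nothing about initial Θ-data. [claim: Mochizuki2012, status: disputed] -/
theorem statement_settingPrVolSharp_of_tame :
    (settingPrVolSharp X hlog M archPk archSub Ψ act Mmod region n lat sig split qData tq t htq0 htq1).Statement :=
  Thm311ToCor312.statement_of_licence
    (bridgeHyps_settingPrVolSharp_of_ideles X hlog M archPk archSub Ψ act Mmod region n lat sig split qData t tq ht0 ht1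
      htq0 htq1)
    (licence_settingPrVolSharp_of_tame X hlog M archPk archSub Ψ act Mmod region n lat sig split qData tq t htq0 htq1 ht0
      pp₀ v₀ hv₀ huniq hp2 he hϖ nq hnq b k hb hk hineq hS ht1)

variable (frobAdm : ℤ → ℤ → ∀ (j : (thetaIndex X).Label) (vQ : (thetaIndex X).VQ),
    Set ((logShellsDH X logv).Packet j vQ) → Prop)
  (frobLogvol : ℤ → ℤ → ∀ (j : (thetaIndex X).Label) (vQ : (thetaIndex X).VQ),
    Set ((logShellsDH X logv).Packet j vQ) → ℝ)
  (frobΨ : ℤ → ℤ → ∀ v : (thetaIndex X).V, v ∈ (thetaIndex X).Vbad → Set ((logShellsDH X logv).StarPacket v))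
  (frobMmod : ℤ → ℤ → ∀ j : (thetaIndex X).LabelStar, Set ((logShellsDH X logv).GlobalPacket j.1))
  (unitImage : ℤ → ℤ → ℕ → ∀ (j : (thetaIndex X).Label) (vQ : (thetaIndex X).VQ),
    Set ((logShellsDH X logv).Packet j vQ))
  (ballImage : ℤ → ℤ → ∀ (j : (thetaIndex X).Label) (vQ : (thetaIndex X).VQ),
    Set ((logShellsDH X logv).Packet j vQ))
  (thetaDiv : ℤ → ℤ → LgpDivisor M (thetaIndex X).lstar)
  (htq_le : ∀ pp x, ‖tq pp x‖ ≤ 1)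

include htq_le

/-- **THE BRANCH-C S_H ANTECEDENT IS SATISFIED at that sharp genuine setting**: there ARE a region reading `ρ` and a
q-datum `qK` with `QPinned ∧ PilotKummerCompatHull` (abc-iut-C-cert-1 `exists_qPinned_and_hull_iff`: the bundle is the
hull inclusion at EVERY label; at the label `0` the Θ-box is the unit box and `‖t_q‖ ≤ 1`). This is the «non-vacuity
witness at honest-type data» for the v3/v4 per-datum IUT-side bundle of `abc_of_S_v3/v4` (C-R10c) that p431727 (3)
showed to be EQUIVALENT, at realising data, to the typed Θ-side inequality — here it holds, for any column structure
(`frobAdm`, …, `thetaDiv` free). [claim: Mochizuki2012, status: disputed] -/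
theorem exists_qPinned_and_pilotKummerCompatHull_settingPrVolSharp_of_tame :
    ∃ (ρ : (∀ v : (thetaIndex X).V, v ∈ (thetaIndex X).Vbad → Set ((logShellsDH X logv).StarPacket v)) →
          ∀ (j : (thetaIndex X).Label) (vQ : (thetaIndex X).VQ), Set ((logShellsDH X logv).Packet j vQ))
      (qK : ∀ v : (thetaIndex X).V, v ∈ (thetaIndex X).Vbad → Set ((logShellsDH X logv).StarPacket v)),
      Cor312Vol.QPinned
          (LatticeSituation.ofShells (logShellsDH X logv) M archPk archSub (summandPiecesPr X hlog).Adm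
            (summandPiecesPr X hlog).logvol Ψ act Mmod region frobAdm frobLogvol frobΨ frobMmod unitImage ballImage thetaDiv)
          (settingPrVolSharp X hlog M archPk archSub Ψ act Mmod region n lat sig split qData tq t htq0 htq1) ρ qK ∧
        Cor312Vol.PilotKummerCompatHull
          (LatticeSituation.ofShells (logShellsDH X logv) M archPk archSub (summandPiecesPr X hlog).Adm
            (summandPiecesPr X hlog).logvol Ψ act Mmod region frobAdm frobLogvol frobΨ frobMmod unitImage ballImage thetaDiv)
          (settingPrVolSharp X hlog M archPk archSub Ψ act Mmod region n lat sig split qData tq t htq0 htq1) ρ qK := by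
  refine (Conditional.Antecedent.exists_qPinned_and_hull_iff
    (LatticeSituation.ofShells (logShellsDH X logv) M archPk archSub (summandPiecesPr X hlog).Adm
      (summandPiecesPr X hlog).logvol Ψ act Mmod region frobAdm frobLogvol frobΨ frobMmod unitImage ballImage thetaDiv)
    (settingPrVolSharp X hlog M archPk archSub Ψ act Mmod region n lat sig split qData tq t htq0 htq1)).2 fun j vQ => ?_
  rcases Fin.eq_zero_or_eq_succ j with rfl | ⟨i, rfl⟩
  · -- the label `0`: `q`-box ⊆ unit box = Θ-box
    rcases vQ with u | pp
    · exact (qRegion_subset_thetaRegion_settingPrVolSharp_inl X hlog M archPk archSub Ψ act Mmod region n lat sig split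
          qData tq t htq0 htq1 0 _ u).trans
        (thetaRegion_subset_thetaHull_settingPrVolSharp X hlog M archPk archSub Ψ act Mmod region n lat sig split qData tq
          t htq0 htq1 0 _ _)
    · haveI : Fact (pp : ℕ).Prime := ⟨pp.2⟩
      refine (qRegion_subset_thetaRegion_settingPrVolSharp_inr X hlog M archPk archSub Ψ act Mmod region n lat sig split
          qData tq t htq0 htq1 ht0 0 _ pp fun x => ?_).trans
        (thetaRegion_subset_thetaHull_settingPrVolSharp X hlog M archPk archSub Ψ act Mmod region n lat sig split qData tq
          t htq0 htq1 0 _ _)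
      rw [labelIdele_zero X t pp x, norm_one]
      exact htq_le pp x
  · exact licence_settingPrVolSharp_of_tame X hlog M archPk archSub Ψ act Mmod region n lat sig split qData tq t htq0 htq1
      ht0 pp₀ v₀ hv₀ huniq hp2 he hϖ nq hnq b k hb hk hineq hS ht1 i vQ

end Assembled

end Summit.ABC.IUTFork.Thm311.Real

end
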